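/-
Copyright: lit-balaban Phase-2 proof seat p30 (gen 6).  Statement-level skeleton of a published paper; no proof claims beyond what
the kernel checks below.
-/
import Literature.MathematicalPhysics.QuantumFieldTheory.BalabanImbrieJaffe1984to88.BIJ85Eq611Torus
import Literature.MathematicalPhysics.QuantumFieldTheory.BalabanImbrieJaffe1984to88.BIJ85Prop522Torus
import Literature.MathematicalPhysics.QuantumFieldTheory.BalabanImbrieJaffe1984to88.BIJ85Eq625Proof
import Literature.MathematicalPhysics.QuantumFieldTheory.BalabanImbrieJaffe1984to88.BIJ85SmallFieldSplit64

/-!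
# `BalabanImbrieJaffe1984to88.BIJ85Eq625Torus` — T. Bałaban, J. Imbrie, A. Jaffe, *Renormalization of the Higgs model: minimizers,
propagators and the stability of mean field theory*, Commun. Math. Phys. **97** (1985) 299–329 [BalabanImbrieJaffe1985]: Sect. 6.2
**(6.2.5)–(6.2.6) (= (6.3.1)) `u_k = u_{k+1} · fluctuation · (gauge transformation)` ON THE TORI of the series** — the MODEL INSTANCE of
gen 1's `BIJ85Eq625Proof.eq625`: every OPERATOR input of the printed derivation (6.2.1)–(6.2.6) is a theorem of the tree's torus
calculus — Q^{e*}_kQ^{e*} = Q^{e*}_{k+1}, Proposition 5.2.2 (5.2.6) with the explicit `D` of (5.2.7), (5.3.1), Proposition 5.1.1 (5.1.1)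
with the explicit `λ_k` of (5.1.13), and `𝒟_{k+1} = 𝒟_k + H_kC^{(k)}H_k^*` from (4.4.4) — for the printed operators `G_{k,Ax}` (5.2.2) =
(4.1.1), `𝒟_k` (4.4.4), `H_{k,Ax}` (4.1.3), the Landau `H_k` (4.4.2), `C^{(k)}` (4.3.3), `D` (5.2.7), `λ_k` (5.1.13) of seat p11's
`BIJ85Prop522Torus`, so that (6.2.5) holds on the tori with NO operator hypothesis (standing range `k + 1 ≤ m + K`, `c ≠ 0`, `w = η^d > 0`,
`2 ≤ d`); the configuration displays (6.2.1) (= the definition (4.5.4) of `u_k`), (6.2.2) (from (6.2)), (6.4) (the small-field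
decomposition) and (6.1.8) (the definition of `B`) enter exactly as printed

statement-level skeleton of published theorems with citation tags; proofs where landed; nothing here is a claim about the Yang–Mills mass gap

PDF held: `paper:balaban1985-cmp97-bij-higgs-minimizers` (journal page = PDF page + 298).  Pages read as images: pp. 319–320
[PDF 21–22] (`HOME/lit-balaban-r15/pages/1985-cmp97-bij-higgs-minimizers-p021-x2.png`, `…-p022-x2.png`), pp. 312–313, 316–317.

CITATION HEADER (lean-in-tree rule).  Part of the lit-balaban TYPED SKELETON (HOME `run/shared/lean/pub/lit-balaban/`), Phase-2
seat p30 (gen 6), unit `lit-balaban-p30`; WHAT IS REPRODUCED = rows **C1.Eq6.2.1-6.2.6** and **C1.Eq6.3.1-6.3.4** (member (6.3.1)) of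
`HOME/SKELETON.md` (reader file `HOME/lit-balaban-r15/ROWS-C1.md`) AT THE TORUS MODEL OF RECORD (kind «model-instance»).

THE PRINTED TEXT (p. 320 [PDF 22], verbatim): *"We have the identity G_{k,Ax}∂^* = 𝒟_k∂^* + ∂D to replace 𝒟_k∂^* by G_{k,Ax}∂^*. Then
we apply again the identity (5.3.1) to replace the first two terms in the exponential by ie_kηH_{k,Ax}B′. This takes care of the
first translation. The second translation (6.1.5) then yields … (6.2.4) We make another gauge transformation to replace the axial
gauge minimizers by Landau gauge minimizers, and we combine the second and third term into an operator 𝒟_{k+1}. After rescaling, the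
L^{−d/2} factor is absorbed and we have u_k = e^{ie_kηH_kB}u_{k+1} (the gauge transformation), (6.2.5) where the gauge transformation
is generated by exp[ie_kD(Q^{e*}_k∂B′) + ie_kλ_k(H_kB) − ie_kL^{−d/2}λ_k(H_kC^{(k)}H_k∂^*Q^{e*}_{k+1}f^{(k+1)})]. (6.2.6)"*; p. 320
(Sect. 6.3): *"u_k = u_{k+1}e^{ie_kηH_kB}e^{iη∂ω}, (6.3.1) where ω denotes the gauge transformation (6.2.6)."*

THE TORUS DATA.  η-bond fields `A = BondSpace P` (Lie-algebra fields, the exponents), U(1)-valued η-bond fields `U = U1Field P 0`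
(`BIJ85Sect1Model`; a commutative group), the exponential `E = exp(ie ·)` bondwise = `BIJ85SmallFieldSplit64.expField e ∘ ofLp` (the
homomorphism `hE` of gen 1 = `expField_ofLp_add`; `e` stands for the printed prefactor `e_kη` of (4.5.2)/(6.2.1), transcript note T4 of
`BIJ85Eq625Proof`), unit bond fields `Bd = CoarseSpace P k` (B, B′), unit / L-lattice plaquette fields `UnitPlaqSpace P k`, `UnitPlaqSpace P
(k+1)`, η-plaquette fields `PlaqSpace P`, gauge functions `EuclideanSpace ℝ (Site P 0)`; the operators: `Q^{s*}_k = QsE P k`, `𝒟_k = DkE P w c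
k` and `𝒟_{k+1} = DkE P w c (k+1)` ((4.4.4) verbatim, p11), `G_{k,Ax} = GaxE P w c k` ((5.2.2) verbatim, p11; = the functional-integral
propagator (4.1.1) `axialPropagator (V411 P k) ∂`, `axialPropagator_eq_GaxE`), `∂ = curlOp w c`, `∂^* = LinearMap.adjoint (curlOp w c)`,
`Q^{e*}_k = QesOp hd w k`, `Q^{e*} = QesOne P hd k` (one step), `Q^{e*}_{k+1} = QesOp hd w (k+1)`, unit curl `dOne P k c`, `H_{k,Ax} = HaxE P w
c k`, `H_k = HkE P w c k` (Landau, (4.4.2)), `H_k^* = LinearMap.adjoint (HkE …)`, `C^{(k)} = CE P w c k`, `∂` on gauge functions = `gradV1 P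
c`, `D = D527E P w c k` ((5.2.7) verbatim), `λ_k = lamE P c k` ((5.1.13)).

WHAT IS PROVED: §1 `expField_ofLp_add` (+ `_zero`/`_neg`/`_sub`): `E` is a homomorphism; §2 the five operator inputs of `eq625` on the
tori — `axialPropagator_eq_GaxE` ((5.2.2): the propagator (4.1.1) IS p11's sum `GaxE`, by induction on p30 gen 3's `eq521_torus'`),
`HaxE_eq_531` ((5.3.1) as an operator identity for `HaxE` with `G_{k,Ax} = GaxE`), `DkE_succ` (`𝒟_{k+1} = 𝒟_k + H_kC^{(k)}H_k^*` from
(4.4.4)), `eq526_torus` ((5.2.6) in the shape `h526`, p11's `prop522_torus_apply`), and (5.1.1)/(6.1.3) = p11's `HaxE_sub_HkE` / gen 5's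
`QesOp_QesOne`; §3 **`eq625_torus`** = (6.2.5)–(6.2.6) (= (6.3.1)) ON THE TORI: `u_k = u_{k+1}·E(H_kB)·E(∂ω)`, `ω = D(Q^{e*}_k∂B′) +
λ_k(H_kB) − L^{−d/2}λ_k(H_kC^{(k)}H_k^*∂^*Q^{e*}_{k+1}f^{(k+1)})`, with the Landau `H_k`, the explicit `D` and `λ_k`, and no operator
hypothesis; the configuration inputs are the printed displays (6.2.1) `h621` (= (4.5.4), the definition of `u_k`), (6.2.2) `h622`, (6.4)
`h64`, (6.1.8) `h618` and `u_{k+1} :=` (4.5.4) at k+1 before rescaling `huk1` (T4); `eq631_torus` (the (6.3.1) ordering).  D-0026: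
theorems only, no `def`, no new named fact.  Unit `lit-balaban-p30` (literature-prover-lit-balaban-p30-g6-0), 2026-08-21.
-/

open scoped BigOperators RealInnerProductSpace

namespace Literature.MathematicalPhysics.QuantumFieldTheory.BalabanImbrieJaffe1984to88.BIJ85Eq625Torus

open Literature.MathematicalPhysics.QuantumFieldTheory.Balaban1983to89
open LatticeFieldCalculus BIJ85Sect1Model BIJ85SmallFieldSplit64 BIJ85AxialPropagator411 BIJ85SigmaForm421 BIJ85UnitPropagator433
  BIJ85Prop521Proof BIJ85Prop521Torus BIJ85Sigma421Torus BIJ85Eq611Structural BIJ85Eq611Torus BIJ85LandauMinimizer442V1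
  BIJ85Prop511Torus BIJ85Prop522Torus

noncomputable section

variable {P : Params}

/-! ## 1. The exponential `E = exp(ie ·)` from Lie-algebra η-bond fields to U(1)-valued η-bond fields is a homomorphism -/

/-- **(4.5.1)–(4.5.2)/(6.2.1)**: the bondwise exponential `A ↦ (exp(ieA_b))_b` of a Lie-algebra η-bond field (`BIJ85SmallFieldSplit64.expField`
read on the Euclidean carrier `BondSpace P`) takes sums to products — the `hE` of gen 1's `BIJ85Eq625Proof.eq625` (`e` = the printed
prefactor `e_kη`). [cite: BalabanImbrieJaffe1985, (4.5.2) p.312] -/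
theorem expField_ofLp_add (e : ℝ) (a a' : BondSpace P) :
    expField e (WithLp.ofLp (a + a')) = expField e (WithLp.ofLp a) * expField e (WithLp.ofLp a') := by
  funext b
  rw [Pi.mul_apply, expField, expField, expField, WithLp.ofLp_add, Pi.add_apply, mul_add, Circle.exp_add]

/-- `exp(ie·0) = 1`. [cite: BalabanImbrieJaffe1985, (4.5.2) p.312] -/
theorem expField_ofLp_zero (e : ℝ) : expField e (WithLp.ofLp (0 : BondSpace P)) = 1 := by
  funext b
  rw [expField, Pi.one_apply, WithLp.ofLp_zero, Pi.zero_apply, mul_zero, Circle.exp_zero]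

/-- `exp(ie(−A)) = exp(ieA)⁻¹`. [cite: BalabanImbrieJaffe1985, (4.5.2) p.312] -/
theorem expField_ofLp_neg (e : ℝ) (a : BondSpace P) :
    expField e (WithLp.ofLp (-a)) = (expField e (WithLp.ofLp a))⁻¹ := by
  rw [eq_inv_iff_mul_eq_one, ← expField_ofLp_add, neg_add_cancel, expField_ofLp_zero]

/-- `exp(ie(A − A′)) = exp(ieA)·exp(ieA′)⁻¹`. [cite: BalabanImbrieJaffe1985, (4.5.2) p.312] -/
theorem expField_ofLp_sub (e : ℝ) (a a' : BondSpace P) :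
    expField e (WithLp.ofLp (a - a')) = expField e (WithLp.ofLp a) * (expField e (WithLp.ofLp a'))⁻¹ := by
  rw [sub_eq_add_neg, expField_ofLp_add, expField_ofLp_neg]

/-! ## 2. The operator inputs of (6.2.3)–(6.2.5) are theorems on the tori -/

/-- **(5.2.2) on the tori: the axial propagator (4.1.1) IS the sum `G_{k,Ax} = Σ_{j<k} H_{j,Ax}C^{(j)}H^*_{j,Ax}`** — p09's functional-integral
operator `axialPropagator (V411 P k) ∂` equals seat p11's `GaxE P w c k` (defined literally by (5.2.2)) for `k ≤ m + K`, `c ≠ 0`, `w > 0`: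
Proposition 5.2.1 iterated (p30 gen 3's `eq521_torus'`, no zero modes p11's `hD_V411`, `G_{0,Ax} = 0` by `V411_zero`/`axialPropagator_bot`).
[cite: BalabanImbrieJaffe1985, Prop. 5.2.1 (5.2.2) p.316] -/
theorem axialPropagator_eq_GaxE {c : ℝ} (hc : c ≠ 0) {w : ℝ} (hw : 0 < w) :
    ∀ {k : ℕ}, k ≤ P.m + P.K → axialPropagator (V411 P k) (curlOp (P := P) w c) = GaxE P w c k
  | 0, _ => by
    rw [GaxE, Finset.sum_range_zero, V411_zero, axialPropagator_bot]
  | k + 1, hk => by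
    have hk' : k ≤ P.m + P.K := by omega
    have ih := axialPropagator_eq_GaxE hc hw hk'
    rw [eq521_torus' hk' c (hD_V411 hk hc hw), ih]
    simp only [GaxE, Finset.sum_range_succ]
    rw [add_comm]
    rfl

/-- **(5.3.1) ON THE TORI as an operator identity** p. 317 [PDF 19], verbatim: *"H_{k,Ax}B = Q^{s*}_kB − G_{k,Ax}∂^*Q^{e*}_k∂B. (5.3.1)"* —
`H_{k,Ax} = Q^{s*}_k − G_{k,Ax}∂^*Q^{e*}_k∂` with `H_{k,Ax} = HaxE`, `G_{k,Ax} = GaxE` ((5.2.2)), `∂^* = adjoint(curlOp w c)`, `Q^{e*}_k = QesOp hd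
w k`, `∂ = dOne P k c` (unit-lattice curl): gen 5's `BIJ85Eq611Structural.Hop_eq_531` with `∂Q^{s*}_k = Q^{e*}_k∂` (`BIJ85Eq611Torus.curlOp_QsE`)
(`H_{k,Ax}`: p11's `HaxE` = p09's `Hop` by the union bridge `Hop_eq_HaxOp`) and `axialPropagator_eq_GaxE`; `k ≤ m + K`, `c ≠ 0`, `w > 0`, `2 ≤ d` (configuration form: p30 gen 3's `BIJ85Eq531Proof.eq531_torus`).
[cite: BalabanImbrieJaffe1985, (5.3.1) p.317] -/
theorem HaxE_eq_531 (hd : 2 ≤ P.d) {k : ℕ} (hk : k ≤ P.m + P.K) {c : ℝ} (hc : c ≠ 0) {w : ℝ} (hw : 0 < w) :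
    HaxE P w c k = QsE P k
      - GaxE P w c k ∘ₗ LinearMap.adjoint (curlOp (P := P) w c) ∘ₗ QesOp (P := P) hd w k ∘ₗ dOne P k c := by
  rw [← axialPropagator_eq_GaxE hc hw hk, show HaxE P w c k = Hop (V411 P k) (curlOp (P := P) w c) (QsE P k) from
    (Hop_eq_HaxOp _ _ _).symm]
  exact Hop_eq_531 (V411 P k) (curlOp (P := P) w c) (QsE P k) (QesOp (P := P) hd w k) (dOne P k c) (curlOp_QsE hd hk w c)

/-- **`𝒟_{k+1} = 𝒟_k + H_kC^{(k)}H_k^*`** — immediate from the verbatim (4.4.4) *"𝒟_k = Σ_{j=0}^{k−1}H_jC^{(j)}H_j^*"* (p11's `DkE`); the input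
`h444` of gen 1 (p. 320: *"we combine the second and third term into an operator 𝒟_{k+1}"*). [cite: BalabanImbrieJaffe1985, (4.4.4) p.312] -/
theorem DkE_succ (w c : ℝ) (k : ℕ) :
    DkE P w c (k + 1) = DkE P w c k + HkE P w c k ∘ₗ CE P w c k ∘ₗ LinearMap.adjoint (HkE P w c k) := by
  simp only [DkE, Finset.sum_range_succ]

/-- **Proposition 5.2.2 (5.2.6) ON THE TORI in the shape `h526` of gen 1**: `G_{k,Ax}∂^*J − 𝒟_k∂^*J = ∂(DJ)` for every plaquette source `J`,
`D` = the explicit (5.2.7) (p11's `prop522_torus_apply`, hypothesis-free; `k ≤ m + K`, `c ≠ 0`, `w > 0`).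
[cite: BalabanImbrieJaffe1985, Prop. 5.2.2 (5.2.6) p.316] -/
theorem eq526_torus {k : ℕ} (hk : k ≤ P.m + P.K) {c : ℝ} (hc : c ≠ 0) {w : ℝ} (hw : 0 < w) (J : PlaqSpace P) :
    GaxE P w c k (LinearMap.adjoint (curlOp (P := P) w c) J) - DkE P w c k (LinearMap.adjoint (curlOp (P := P) w c) J) =
      gradV1 P c (D527E P w c k J) := by
  rw [prop522_torus_apply hk hc hw J, add_sub_cancel_left]

/-! ## 3. (6.2.5)–(6.2.6) = (6.3.1) on the tori -/

/-- **(6.2.5)–(6.2.6) ON THE TORI** p. 320 [PDF 22], verbatim: *"u_k = e^{ie_kηH_kB}u_{k+1} (the gauge transformation), (6.2.5) where the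
gauge transformation is generated by exp[ie_kD(Q^{e*}_k∂B′) + ie_kλ_k(H_kB) − ie_kL^{−d/2}λ_k(H_kC^{(k)}H_k∂^*Q^{e*}_{k+1}f^{(k+1)})]. (6.2.6)"* —
in the commutative group of U(1)-valued η-bond fields `U1Field P 0`, every exponential the bondwise `E = exp(ie ·)` (`expField e ∘ ofLp`,
`e` = the printed `e_kη`, T4 of gen 1): `u_k = u_{k+1}·E(H_kB)·E(∂ω)` with `ω = D(Q^{e*}_k∂B′) + λ_k(H_kB) − lλ_k(H_kC^{(k)}H_k^*∂^*Q^{e*}_{k+1}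
f^{(k+1)})` (`l = L^{−d/2}`), where NOW `H_k = HkE` is the Landau minimizer (4.4.2), `C^{(k)} = CE` (4.3.3), `D = D527E` the explicit (5.2.7),
`λ_k = lamE` the explicit (5.1.13), `𝒟_k, 𝒟_{k+1} = DkE` (4.4.4), `G_{k,Ax} = GaxE` (5.2.2) = (4.1.1), `Q^{s*}_k = QsE`, `Q^{e*}_k = QesOp hd w
k`, `Q^{e*} = QesOne`, `∂ = dOne` (unit) / `curlOp w c` (η-lattice) / `gradV1 P c` (gauge functions) — and ALL FIVE OPERATOR INPUTS of gen
1's `eq625` are DISCHARGED: `Q^{e*}_kQ^{e*} = Q^{e*}_{k+1}` (`QesOp_QesOne`), (5.2.6) (`eq526_torus`), (5.3.1) (`HaxE_eq_531`), (5.1.1) with λ =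
λ_k(H_kB) (p11's `HaxE_sub_HkE`), `𝒟_{k+1} = 𝒟_k + H_kC^{(k)}H_k^*` (`DkE_succ`).  The configuration inputs are the printed displays: (6.2.1)
`h621` (= the definition (4.5.4) of `u_k` *"with u in place of v"*, `Qsu` = Q^{s*}_ku), (6.2.2) `h622` (`Qsv` = Q^{s*}_{k+1}v), (6.4) `h64`
(small-field decomposition of f^{(k)}), (6.1.8) `h618` (definition of `B`), and `u_{k+1} := (Q^{s*}_{k+1}v)·E(−l𝒟_{k+1}∂^*Q^{e*}_{k+1}f^{(k+1)})`
`huk1` (= (4.5.4) at k+1 before rescaling, T4).  Standing range `k + 1 ≤ m + K`, `c ≠ 0`, `w = η^d > 0`, `2 ≤ d`.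
[cite: BalabanImbrieJaffe1985, (6.2.5)–(6.2.6) p.320] -/
theorem eq625_torus (hd : 2 ≤ P.d) {k : ℕ} (hk : k + 1 ≤ P.m + P.K) {c : ℝ} (hc : c ≠ 0) {w : ℝ} (hw : 0 < w)
    (e l : ℝ) (uk uk1 Qsu Qsv : U1Field P 0) (fk : UnitPlaqSpace P k) (fL : UnitPlaqSpace P (k + 1)) (B' B : CoarseSpace P k)
    (h621 : uk = Qsu * expField e (WithLp.ofLp
      (-(DkE P w c k (LinearMap.adjoint (curlOp (P := P) w c) (QesOp (P := P) hd w k fk))))))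
    (h622 : Qsu = Qsv * expField e (WithLp.ofLp (QsE P k B')))
    (h64 : fk = dOne P k c B' + l • QesOne P hd k fL)
    (h618 : B = B' + l • CE P w c k (LinearMap.adjoint (HkE P w c k)
      (LinearMap.adjoint (curlOp (P := P) w c) (QesOp (P := P) hd w (k + 1) fL))))
    (huk1 : uk1 = Qsv * expField e (WithLp.ofLp
      (-(l • DkE P w c (k + 1) (LinearMap.adjoint (curlOp (P := P) w c) (QesOp (P := P) hd w (k + 1) fL)))))) :
    uk = uk1 * expField e (WithLp.ofLp (HkE P w c k B)) *
      expField e (WithLp.ofLp (gradV1 P c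
        (D527E P w c k (QesOp (P := P) hd w k (dOne P k c B')) + lamE P c k (HkE P w c k B)
          - l • lamE P c k (HkE P w c k (CE P w c k (LinearMap.adjoint (HkE P w c k)
              (LinearMap.adjoint (curlOp (P := P) w c) (QesOp (P := P) hd w (k + 1) fL)))))))) := by
  have hk' : k ≤ P.m + P.K := by omega
  exact BIJ85Eq625Proof.eq625 (fun a => expField e (WithLp.ofLp a)) (expField_ofLp_add e) (QsE P k) (DkE P w c k)
    (DkE P w c (k + 1)) (GaxE P w c k) (LinearMap.adjoint (curlOp (P := P) w c)) (QesOp (P := P) hd w k) (QesOne P hd k)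
    (QesOp (P := P) hd w (k + 1)) (dOne P k c) (HaxE P w c k) (HkE P w c k) (LinearMap.adjoint (HkE P w c k)) (CE P w c k)
    (gradV1 P c) (D527E P w c k) (lamE P c k) (QesOp_QesOne hd w k) (fun J => eq526_torus hk' hc hw J) (HaxE_eq_531 hd hk' hc hw)
    (fun b => HaxE_sub_HkE hk' hc hw b) (DkE_succ w c k) l uk uk1 Qsu Qsv fk fL B' B h621 h622 h64 h618 huk1

/-- **(6.3.1) ON THE TORI** p. 320 [PDF 22], verbatim: *"In Sect. 6.2 we established the general decomposition (6.2.5) for u_k, u_k =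
u_{k+1}e^{ie_kηH_kB}e^{iη∂ω}, (6.3.1) where ω denotes the gauge transformation (6.2.6)."* — `eq625_torus` read in this order, the gauge
factor as `E` of the gradient of the single gauge function `ω`. [cite: BalabanImbrieJaffe1985, (6.3.1) p.320] -/
theorem eq631_torus (hd : 2 ≤ P.d) {k : ℕ} (hk : k + 1 ≤ P.m + P.K) {c : ℝ} (hc : c ≠ 0) {w : ℝ} (hw : 0 < w)
    (e l : ℝ) (uk uk1 Qsu Qsv : U1Field P 0) (fk : UnitPlaqSpace P k) (fL : UnitPlaqSpace P (k + 1)) (B' B : CoarseSpace P k)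
    (h621 : uk = Qsu * expField e (WithLp.ofLp
      (-(DkE P w c k (LinearMap.adjoint (curlOp (P := P) w c) (QesOp (P := P) hd w k fk))))))
    (h622 : Qsu = Qsv * expField e (WithLp.ofLp (QsE P k B')))
    (h64 : fk = dOne P k c B' + l • QesOne P hd k fL)
    (h618 : B = B' + l • CE P w c k (LinearMap.adjoint (HkE P w c k)
      (LinearMap.adjoint (curlOp (P := P) w c) (QesOp (P := P) hd w (k + 1) fL))))
    (huk1 : uk1 = Qsv * expField e (WithLp.ofLp
      (-(l • DkE P w c (k + 1) (LinearMap.adjoint (curlOp (P := P) w c) (QesOp (P := P) hd w (k + 1) fL)))))) :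
    let ω : EuclideanSpace ℝ (Site P 0) :=
      D527E P w c k (QesOp (P := P) hd w k (dOne P k c B')) + lamE P c k (HkE P w c k B)
        - l • lamE P c k (HkE P w c k (CE P w c k (LinearMap.adjoint (HkE P w c k)
            (LinearMap.adjoint (curlOp (P := P) w c) (QesOp (P := P) hd w (k + 1) fL)))))
    uk = uk1 * expField e (WithLp.ofLp (HkE P w c k B)) * expField e (WithLp.ofLp (gradV1 P c ω)) :=
  eq625_torus hd hk hc hw e l uk uk1 Qsu Qsv fk fL B' B h621 h622 h64 h618 huk1

end

end Literature.MathematicalPhysics.QuantumFieldTheory.BalabanImbrieJaffe1984to88.BIJ85Eq625Torus
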